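import Summits.QuantumFields.QCD.Theorems.QuarksAsStableActionStableActionBridgeStubSliceDataSuConj
import Summits.QuantumFields.QCD.Theorems.QuarksAsStableActionStableActionBridgeStubBondKernelContinuous
import Summits.QuantumFields.QCD.Theorems.QuarksAsStableActionStableActionBridgeStubEigenRayleigh
import Summits.QuantumFields.QCD.Theorems.QuarksAsStableActionStableActionBridgeFermionSliceContinuous
import Summits.QuantumFields.QCD.Theorems.QuarksAsStableActionStableActionBridgeTransferPositivity
import HarnessLib

/-!
# Charge conjugation of slice wave functions commutes with the QCD transfer map
(stub `stub_transferWave_chargeConj` of line `twisted_trace_transfer` for crux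
`QuarksAsStableAction.StableActionBridge`, item stmt-QuantumFields-9737, `--supports`; sub-goal V4)

To prove that the vacuum of Lüscher's transfer matrix of lattice QCD is fermion-even, the line
`twisted_trace_transfer` uses the charge conjugation `(𝒞Ψ)(U) := V Ψ(Ū)` on the wave functions of one
time slice (`Ū e := suConj 3 (U e)`, entrywise complex conjugation of all spatial links; in the line `V` is
particle–hole conjugation times a spin rotation of the slice Fock space).  Here `V` is an abstract matrix
and its three intertwining properties are HYPOTHESES: with the Fock gauge rotations,
`Γ(G_g) V = V Γ(G_ḡ)`; with Smit's fermionic transfer operator, `T̂_F(U) V = V T̂_F(Ū)`; and with the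
Gauss-averaged Wilson bond kernel `B(U,U')_{ac} = ∫ K_β(U, U'^g) Γ(G_g)_{ac} dg`, `B(U,U') V = V B(Ū,Ū')`.
For a continuous wave `Ψ` the stub proves:

1. `𝒞Ψ` is continuous (`U ↦ Ū` is continuous, `StubSliceDataSuConj.continuous_suConj` coordinatewise, and
   multiplication by the constant matrix `V` is continuous);
2. `𝒞Ψ` is gauge invariant if `Ψ` is:
   `(𝒞Ψ)(U^h) = V Ψ((U^h)‾) = V Ψ(Ū^{h̄}) = V Γ(G_{h̄}) Ψ(Ū) = Γ(G_h) V Ψ(Ū) = Γ(G_h) (𝒞Ψ)(U)`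
   (`(U^h)‾ = Ū^{h̄}` is `StubSliceDataSuConj.gaugeTransform_suConj`);
3. `𝒞` commutes with the wave-level transfer map `(𝒯Ψ)(U) = ∫ B(U,U') T̂_F(U') Ψ(U') dU'`, i.e.
   `(𝒯𝒞Ψ)(U) = V (𝒯Ψ)(Ū)`.  Pointwise `B(U,U') T̂_F(U') V Ψ(Ū') = V B(Ū,Ū') T̂_F(Ū') Ψ(Ū')` by the two
   intertwining hypotheses (`Matrix.mulVec_mulVec`, `Matrix.mul_assoc`), so the integrand is `G(Ū')` with
   `G(W) = (V B(Ū,W) T̂_F(W) Ψ(W))_a`; the substitution `U' ↦ Ū'` is a measure-preserving involution of the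
   product Haar measure `sliceHaar` (`StubSliceDataSuConj.measurePreserving_sliceHaar_suConj`,
   `suConj_suConj`, `MeasurableEquiv.ofInvolutive`, `MeasurePreserving.integral_comp`), so
   `∫ G(Ū') dU' = ∫ G(W) dW`; finally the constant matrix `V` is pulled out of the integral entry by entry
   (a finite sum of integrable functions, `StubEigenRayleigh.sum_mul_integral`: the integrand is continuous —
   `stub_bondKernel_continuous`, `Sketch.continuous_fermionSliceOp` — on the compact probability space of
   spatial links, `Sketch.integrable_sliceHaar_of_continuous`).

Item 3 and the continuity of the transfer integrand are proved for an abstract bond kernel with jointly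
continuous entries, an abstract continuous multiplication operator and an abstract measure-preserving
involution (`section Abstract`), and specialised at the end (as in `StubEigenRayleigh`).  The unitarity of
`V` is part of the registered signature but is not needed for these three facts.  Pure theorem file (no
definitions, no notation); helpers in the sub-namespace `StubTransferWaveChargeConj`.

[cite: Smit2023, §4.6 (4.127)–(4.137) and §6.5 (6.87)] [cite: LuciniEtAl2016, §6]
-/

noncomputable section

open MeasureTheory
open scoped Matrix BigOperators ComplexConjugate
open Literature.MathematicalPhysics.QuantumFieldTheory Literature.MathematicalPhysics.QuantumLattice
open Literature.Probability.LatticeModels (TorusSite)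

namespace Summit.QuantumFields.QCD.Cruxes.StableActionBridge.TwistedTraceTransfer

namespace StubTransferWaveChargeConj

/-! ### Abstract part: a bond kernel `B`, a multiplication operator `T`, an involution `σ` -/

section Abstract

variable {X : Type*} {F : Type*} [Fintype F]

/-- A constant matrix comes out of the integral of a vector-valued function, entry by entry:
`∫ (V f(W))_a dW = (V ∫ f(W) dW)_a` (finite sums of integrable functions). [folklore] -/
theorem integral_mulVec_apply [MeasurableSpace X] {μ : Measure X} (V : Matrix F F ℂ) {f : X → F → ℂ}
    (hf : ∀ a', Integrable (fun W => f W a') μ) (a : F) :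
    ∫ W, (V *ᵥ f W) a ∂μ = (V *ᵥ fun a' => ∫ W, f W a' ∂μ) a := by
  simp only [Matrix.mulVec, dotProduct]
  exact (StubEigenRayleigh.sum_mul_integral (fun a' => V a a') hf).symm

/-- Substitution by a measure-preserving involution: `∫ G(σ U') dU' = ∫ G(W) dW`. [folklore] -/
theorem integral_comp_involutive [MeasurableSpace X] {μ : Measure X} {σ : X → X}
    (hσ : MeasurePreserving σ μ μ) (hσσ : Function.Involutive σ) (G : X → ℂ) :
    ∫ U', G (σ U') ∂μ = ∫ W, G W ∂μ :=
  hσ.integral_comp (MeasurableEquiv.ofInvolutive σ hσσ hσ.measurable).measurableEmbedding G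

/-- The pointwise algebra of charge conjugation under the transfer integrand: if `T(U') V = V T(σU')` and
`B(U,U') V = V B(σU, σU')` then `B(U,U') T(U') V = V (B(σU, σU') T(σU'))`. [folklore] -/
theorem bond_mul_op_mul_intertwiner {σ : X → X} {B : X → X → Matrix F F ℂ} {T : X → Matrix F F ℂ}
    {V : Matrix F F ℂ} (hT : ∀ U, T U * V = V * T (σ U))
    (hB : ∀ U U', B U U' * V = V * B (σ U) (σ U')) (U U' : X) :
    B U U' * T U' * V = V * (B (σ U) (σ U') * T (σ U')) := by
  rw [Matrix.mul_assoc, hT, ← Matrix.mul_assoc, hB, Matrix.mul_assoc]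

variable [TopologicalSpace X]

/-- The transfer integrand `U' ↦ (B(W,U') T(U') Ψ(U'))_{a'}` is continuous, for a bond kernel with jointly
continuous entries, a continuous `T` and a continuous wave `Ψ`. [folklore] -/
theorem continuous_transferIntegrand {B : X → X → Matrix F F ℂ}
    (hBc : ∀ a c, Continuous fun p : X × X => B p.1 p.2 a c) {T : X → Matrix F F ℂ} (hTc : Continuous T)
    {Ψ : X → F → ℂ} (hΨ : Continuous Ψ) (W : X) (a' : F) :
    Continuous fun U' => ((B W U' * T U') *ᵥ Ψ U') a' := by
  have hB2 : Continuous fun p : X × X => B p.1 p.2 := continuous_matrix hBc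
  have hBW : Continuous fun U' : X => B W U' := hB2.comp' (Continuous.prodMk_right W)
  exact (continuous_apply a').comp' ((hBW.mul hTc).matrix_mulVec hΨ)

/-- **Charge conjugation commutes with the transfer map (abstract form).**  For a measure-preserving
involution `σ`, a bond kernel `B` with jointly continuous entries, a continuous `T`, a matrix `V` with
`T(U) V = V T(σU)` and `B(U,U') V = V B(σU, σU')`, and a continuous wave `Ψ` (continuous functions being
integrable): `∫ B(U,U') T(U') V Ψ(σU') dU' = V ∫ B(σU, U') T(U') Ψ(U') dU'`, entry by entry. [folklore] -/
theorem transfer_chargeConj [MeasurableSpace X] {μ : Measure X} {σ : X → X}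
    (hσ : MeasurePreserving σ μ μ) (hσσ : Function.Involutive σ)
    {B : X → X → Matrix F F ℂ} (hBc : ∀ a c, Continuous fun p : X × X => B p.1 p.2 a c)
    {T : X → Matrix F F ℂ} (hTc : Continuous T) {V : Matrix F F ℂ}
    (hT : ∀ U, T U * V = V * T (σ U)) (hB : ∀ U U', B U U' * V = V * B (σ U) (σ U'))
    (hI : ∀ f : X → ℂ, Continuous f → Integrable f μ) {Ψ : X → F → ℂ} (hΨ : Continuous Ψ)
    (U : X) (a : F) :
    (∫ U', ((B U U' * T U') *ᵥ (V *ᵥ Ψ (σ U'))) a ∂μ) =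
      (V *ᵥ fun a' => ∫ U', ((B (σ U) U' * T U') *ᵥ Ψ U') a' ∂μ) a := by
  have key : ∀ U', ((B U U' * T U') *ᵥ (V *ᵥ Ψ (σ U'))) a =
      (V *ᵥ ((B (σ U) (σ U') * T (σ U')) *ᵥ Ψ (σ U'))) a := fun U' => by
    simp only [Matrix.mulVec_mulVec, bond_mul_op_mul_intertwiner hT hB]
  calc ∫ U', ((B U U' * T U') *ᵥ (V *ᵥ Ψ (σ U'))) a ∂μ
      = ∫ U', (V *ᵥ ((B (σ U) (σ U') * T (σ U')) *ᵥ Ψ (σ U'))) a ∂μ :=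
        integral_congr_ae (Filter.Eventually.of_forall key)
    _ = ∫ W, (V *ᵥ ((B (σ U) W * T W) *ᵥ Ψ W)) a ∂μ :=
        integral_comp_involutive hσ hσσ (fun W => (V *ᵥ ((B (σ U) W * T W) *ᵥ Ψ W)) a)
    _ = (V *ᵥ fun a' => ∫ W, ((B (σ U) W * T W) *ᵥ Ψ W) a' ∂μ) a :=
        integral_mulVec_apply V (f := fun W => (B (σ U) W * T W) *ᵥ Ψ W)
          (fun a' => hI _ (continuous_transferIntegrand hBc hTc hΨ (σ U) a')) a

end Abstract

/-! ### The QCD slice -/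

variable {Nf S : ℕ}

/-- Charge conjugation of all links of a configuration, `U ↦ Ū`, is continuous. [folklore] -/
theorem continuous_config_suConj (ι : Type*) (N : ℕ) :
    Continuous fun U : ι → Matrix.specialUnitaryGroup (Fin N) ℂ => fun i => suConj N (U i) :=
  continuous_pi fun i => (StubSliceDataSuConj.continuous_suConj N).comp (continuous_apply i)

/-- `U ↦ Ū` is an involution on configurations (`suConj_suConj`). [folklore] -/
theorem involutive_config_suConj (ι : Type*) (N : ℕ) :
    Function.Involutive fun U : ι → Matrix.specialUnitaryGroup (Fin N) ℂ => fun i => suConj N (U i) :=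
  fun U => funext fun i => suConj_suConj N (U i)

/-- **`𝒞Ψ` is continuous**: `U ↦ V Ψ(Ū)` is continuous for a continuous wave `Ψ`. [folklore] -/
theorem continuous_chargeConjWave [NeZero S]
    (V : Matrix (Finset (SliceFermiIdx Nf S)) (Finset (SliceFermiIdx Nf S)) ℂ) {Ψ : SliceWave Nf S}
    (hΨ : Continuous Ψ) :
    Continuous fun U : GaugeConfig 3 S (Matrix.specialUnitaryGroup (Fin 3) ℂ) =>
      V *ᵥ Ψ (fun e => suConj 3 (U e)) :=
  continuous_const.matrix_mulVec (hΨ.comp' (continuous_config_suConj (Edge 3 S) 3))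

/-- **`𝒞Ψ` is gauge invariant if `Ψ` is**: `(𝒞Ψ)(U^h) = V Ψ((U^h)‾) = V Ψ(Ū^{h̄}) = V Γ(G_{h̄}) Ψ(Ū)
= Γ(G_h) V Ψ(Ū) = Γ(G_h) (𝒞Ψ)(U)`. [cite: Smit2023, §4.6 (4.127)–(4.137)] -/
theorem isGaugeInvariantWave_chargeConjWave [NeZero S]
    {V : Matrix (Finset (SliceFermiIdx Nf S)) (Finset (SliceFermiIdx Nf S)) ℂ}
    (hΓ : ∀ g : TorusSite 3 S → Matrix.specialUnitaryGroup (Fin 3) ℂ,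
      fockGaugeAct (Nf := Nf) g * V = V * fockGaugeAct (Nf := Nf) (fun x => suConj 3 (g x)))
    {Ψ : SliceWave Nf S} (hΨ : IsGaugeInvariantWave Ψ) :
    IsGaugeInvariantWave fun U : GaugeConfig 3 S (Matrix.specialUnitaryGroup (Fin 3) ℂ) =>
      V *ᵥ Ψ (fun e => suConj 3 (U e)) := by
  intro g U
  have hσ : (fun e => suConj 3 (gaugeTransform g U e)) =
      gaugeTransform (fun x => suConj 3 (g x)) (fun e => suConj 3 (U e)) :=
    (StubSliceDataSuConj.gaugeTransform_suConj g U).symm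
  have hΨ' := hΨ (fun x => suConj 3 (g x)) (fun e => suConj 3 (U e))
  show V *ᵥ Ψ (fun e => suConj 3 (gaugeTransform g U e)) =
    fockGaugeAct g *ᵥ (V *ᵥ Ψ fun e => suConj 3 (U e))
  rw [hσ, hΨ', Matrix.mulVec_mulVec, Matrix.mulVec_mulVec, hΓ]

end StubTransferWaveChargeConj

open StubTransferWaveChargeConj in
/-- **Sub-goal V4 (registered stub `stub_transferWave_chargeConj`): charge conjugation on gauge-invariant
waves commutes with the transfer map.**  For a unitary `V` with `Γ(G_g) V = V Γ(G_ḡ)`, `T̂_F(U) V = V T̂_F(Ū)`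
and `B(U,U') V = V B(Ū,Ū')` (`B` the Gauss-averaged Wilson bond kernel), the wave `(𝒞Ψ)(U) = V Ψ(Ū)` of a
continuous `Ψ` is continuous, gauge invariant if `Ψ` is, and `(𝒯𝒞Ψ)(U) = V (𝒯Ψ)(Ū)` for the transfer map
`(𝒯Ψ)(U) = ∫ B(U,U') T̂_F(U') Ψ(U') dU'` (the intertwining hypotheses pointwise, the Haar invariance of the
spatial links under `suConj`, and finite sums through the integral).
[cite: Smit2023, §4.6 (4.127)–(4.137) and §6.5 (6.87)] -/
theorem stub_transferWave_chargeConj : ∀ (Nf S : ℕ) [NeZero S] (β : ℝ) (mq : Fin Nf → ℝ), (∀ f, -1 < mq f) →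
    ∀ V : Matrix (Finset (SliceFermiIdx Nf S)) (Finset (SliceFermiIdx Nf S)) ℂ, V ∈ Matrix.unitaryGroup (Finset (SliceFermiIdx Nf S)) ℂ →
    (∀ g : TorusSite 3 S → (Matrix.specialUnitaryGroup (Fin 3) ℂ), @fockGaugeAct Nf S _ g * V = V * @fockGaugeAct Nf S _ (fun x => suConj 3 (g x))) →
    (∀ U : GaugeConfig 3 S (Matrix.specialUnitaryGroup (Fin 3) ℂ), fermionSliceOp U mq * V = V * fermionSliceOp (fun e => suConj 3 (U e)) mq) →
    (∀ U U' : GaugeConfig 3 S (Matrix.specialUnitaryGroup (Fin 3) ℂ),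
      (Matrix.of fun a c => ∫ g : TorusSite 3 S → (Matrix.specialUnitaryGroup (Fin 3) ℂ),
            (gaugeSliceKernel β U (gaugeTransform g U') : ℂ) * @fockGaugeAct Nf S _ g a c
              ∂(Measure.pi fun _ => haarProbability (Matrix.specialUnitaryGroup (Fin 3) ℂ))) * V =
      V * (Matrix.of fun a c => ∫ g : TorusSite 3 S → (Matrix.specialUnitaryGroup (Fin 3) ℂ),
            (gaugeSliceKernel β (fun e => suConj 3 (U e)) (gaugeTransform g (fun e => suConj 3 (U' e))) : ℂ) * @fockGaugeAct Nf S _ g a c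
              ∂(Measure.pi fun _ => haarProbability (Matrix.specialUnitaryGroup (Fin 3) ℂ)))) →
    ∀ Ψ : SliceWave Nf S, Continuous Ψ →
      Continuous (fun U : GaugeConfig 3 S (Matrix.specialUnitaryGroup (Fin 3) ℂ) => V *ᵥ Ψ (fun e => suConj 3 (U e))) ∧
      (IsGaugeInvariantWave Ψ →
        IsGaugeInvariantWave (fun U : GaugeConfig 3 S (Matrix.specialUnitaryGroup (Fin 3) ℂ) => V *ᵥ Ψ (fun e => suConj 3 (U e)))) ∧
      ∀ (U : GaugeConfig 3 S (Matrix.specialUnitaryGroup (Fin 3) ℂ)) (a : Finset (SliceFermiIdx Nf S)),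
        (∫ U', (((Matrix.of fun a' c => ∫ g : TorusSite 3 S → (Matrix.specialUnitaryGroup (Fin 3) ℂ),
            (gaugeSliceKernel β U (gaugeTransform g U') : ℂ) * @fockGaugeAct Nf S _ g a' c
              ∂(Measure.pi fun _ => haarProbability (Matrix.specialUnitaryGroup (Fin 3) ℂ))) * fermionSliceOp U' mq) *ᵥ
            (V *ᵥ Ψ (fun e => suConj 3 (U' e)))) a ∂(sliceHaar S)) =
        (V *ᵥ fun a' => ∫ U', (((Matrix.of fun a'' c => ∫ g : TorusSite 3 S → (Matrix.specialUnitaryGroup (Fin 3) ℂ),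
            (gaugeSliceKernel β (fun e => suConj 3 (U e)) (gaugeTransform g U') : ℂ) * @fockGaugeAct Nf S _ g a'' c
              ∂(Measure.pi fun _ => haarProbability (Matrix.specialUnitaryGroup (Fin 3) ℂ))) * fermionSliceOp U' mq) *ᵥ Ψ U') a' ∂(sliceHaar S)) a := by
  intro Nf S _ β mq hm V _ hΓ hT hB Ψ hΨ
  refine ⟨continuous_chargeConjWave V hΨ, isGaugeInvariantWave_chargeConjWave hΓ, fun U a => ?_⟩
  exact transfer_chargeConj
    (B := fun U U' => Matrix.of fun a c => ∫ g : TorusSite 3 S → (Matrix.specialUnitaryGroup (Fin 3) ℂ),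
      (gaugeSliceKernel β U (gaugeTransform g U') : ℂ) * @fockGaugeAct Nf S _ g a c
        ∂(Measure.pi fun _ => haarProbability (Matrix.specialUnitaryGroup (Fin 3) ℂ)))
    (T := fun U' => fermionSliceOp U' mq)
    StubSliceDataSuConj.measurePreserving_sliceHaar_suConj (involutive_config_suConj (Edge 3 S) 3)
    (fun a' c => by simpa only [Matrix.of_apply] using stub_bondKernel_continuous Nf S β a' c)
    (Sketch.continuous_fermionSliceOp Nf S mq hm) hT hB
    (fun f hf => Sketch.integrable_sliceHaar_of_continuous hf) hΨ U a

end Summit.QuantumFields.QCD.Cruxes.StableActionBridge.TwistedTraceTransfer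

end
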